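import Summits.HodgeConjecture.HodgeConjecture.Theorems.VHCAbelianSchemesRoadDegreeConfinement
import Summits.HodgeConjecture.HodgeConjecture.Theorems.VHCAbelianSchemesRoadSemiregularSheafRepresentativesTwAtStubLefschetzRegimeTw
import Summits.HodgeConjecture.HodgeConjecture.Theorems.Ring2BindersAbelianSchemeVHCMiddleLift
import Summits.HodgeConjecture.HodgeConjecture.Theorems.Ring2BindersAbelianSchemeVHCRungs
import HarnessLib

/-!
# Road b02 (`VHCAbelianSchemesRoad`, D-0059) — THE CRUX ON THE ROAD'S CRITICAL PATH IS ITS DIAGONAL `(2m, m)`: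
# K-SR♭∃ in the MIDDLE degree of EVEN-dimensional pencils already gives ring 2's node (U), row b02 and `HC_AV`

research route conditional on HC_CM; not a corollary; Q11.4-sentence-2 already refuted in dim ≥ 3.
(cell line of seat ab-andre-2: research route, not a corollary; conditional on HC_CM plus one named minimal statement.)

THEOREMS ONLY (no definition, no named fact, no sorry; `HC_CM` occurs nowhere; nothing of the road's research content —
a semiregular (twisted) carrier on some fibre — is claimed). Seat ab-andre-2 gen 55, PART X.

WHAT THIS FILE PROVES. The crux K-SR♭∃ = `AdmissibleRepresentativesLefAt 𝒪` (item 19274 over the twisted door, aside 19779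
over the sheaf door) quantifies over one-parameter abelian schemes of EVERY relative dimension `n` and classes of EVERY
codimension `p`; PART W (`VHCAbelianSchemesRoadDegreeConfinement.lean`) confined its content to `2 ≤ p ≤ n − 2`, first pair
`(4, 2)`, and recorded that the CARRIER statement does not halve in `p`. Here the crux is confined FOR THE ROAD'S PURPOSE —
ring 2's node (U) `OneParameterAbelianSchemeVHCUncountable`, hence row b02 `AbelianSchemeVHC`, hence the leaf `HC_AV` — to its
DIAGONAL cells `(n, p) = (2m, m)`:
* §1 tools: `𝒳 × B` is quasi-projective for `𝒳` quasi-projective and `B` projective (base change of the open immersion, Segre);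
  a section of `f` gives the section `(e, 0_B)` of the padded family `𝒳 × B ⟶ S`.
* §2 per pencil: ONE `𝒪`-admissible datum `κ_p = a·W| + Z|` at one fibre plus the door `LocalVariationalHodgeFor 𝒪` makes the
  algebraicity locus of `W` UNCOUNTABLE (the landed proof of `oneParameterAbelianSchemeVHCUncountable_of_lefAt`, p408365, with
  the crux's `∀` replaced by the datum it delivers).
* §3 the engine: `W` of codimension `p` is moved to the lower half by ring2-b02's LOWER SHADOW (`Ring2.Binders.exists_lowerShadow`,
  Lieberman's `B(A)` on the fibres), then to the MIDDLE degree of the padded pencil `𝒳 × B ⟶ S`, `dim B = n − 2p`, by ring2-b02's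
  MIDDLE LIFT (`Ring2.Binders.exists_middleLift`, BFNP Lemma 48); both moves preserve the algebraicity locus AS A SET, and the
  padded pencil is again a one-parameter abelian scheme over the same affine curve, with a section and quasi-projective total
  space (§1) — so the graded crux `AdmissibleRepresentativesLefAtDeg 𝒪 (2(n − p)) (n − p)` applies to it and §2 concludes for `W`.
* §4 the nodes: (U) — for EVERY `(n, p)` — from the door and the diagonal cells `(2m, m)`, `m ≥ 2`, FACT-FREE (relative
  dimension `≤ 3` is unconditional, `Ring2.ClassTargets.hcUpToDim_three`); and from the door, the diagonal cells `m ≥ 3` and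
  `HCUpToDim 5` (= the support item `HodgeAbelianDimLeFive`, Markman 2025 Cor. 1.3, UNREFEREED); hence row b02 (curve residual)
  and `HC_AV` (André 1996 #21/#22); §5 the same in the `closes`-shape of the road over the TWISTED door, with the binder
  `SemiregularSheafRepresentativesTwAt` REPLACED by its diagonal slice `∀ C m, 3 ≤ m → LefAtExceptionalRegimeAt (twisted door) (2m) m`.

CONSEQUENCE FOR THE ROAD: of the `(n, p)`-table of regime 2 (RING2-MAP AA2.435) only the diagonal `(6,3), (8,4), (10,5), …`
is load-bearing for `HC_AV` (modulo Markman ≤ 5; `(4,2), (6,3), …` fact-free); the cells `(4,2)` («fourfold pencils: none in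
print»), `(5,2)`, `(6,2)`, `(6,4)`, `(7,·)`, … are OFF the critical path — a carrier there is never consumed. The BC5 rung
`LefAtExceptionalRegimeSixfoldMiddle = (6,3)` is thereby the FIRST cell on the path; Markman's split-Weil SIXFOLD carriers
(arXiv:2502.03415 Thm. 1.5.1, `p = 3`) sit exactly on it. NOT claimed: any cell of the crux (the carrier statements at `(4,2)`
etc. stay OPEN — bypassed, not proved); the converse «`HC_AV` ⟹ diagonal crux»; anything about `HC_CM`.

References: [BrosnanFangNiePearlstein2009] §6 Lemma 48; [Lieberman1968]; [KerrPearlstein2011] §3.1; [CharlesSchnell2014Notes]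
Conj. 11.3.1, Prop. 11.3.11, Cor. 11.3.6; [BuchweitzFlenner2003] §5 Thm. 5.1; [Bloch1972Semiregularity] Rem. (7.5);
[vanGeemen1994HodgeAV] §2.4; [Markman2025SurveySecant] Cor. 1.3; [Markman2025SecantWeil] Thm. 1.5.1; [Andre1996Motifs] §6.3;
[GortzWedhorn2023] Thm. 27.291; [Hartshorne1977] II Ex. 4.9, II.3 p. 89; [SerreGAGA1956] §2 n°5–6.
-/

noncomputable section

open CategoryTheory CategoryTheory.Limits AlgebraicGeometry Topology MonoidalCategory CartesianMonoidalCategory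

namespace Summit.HodgeConjecture.HodgeConjecture.Ring2.SemiregularRepresentatives

set_option linter.dupNamespace false -- the cell's namespace repeats the summit name, as in every `Ring2*` file

open Literature.AlgebraicGeometry Literature.AlgebraicGeometry.Motives Literature.AlgebraicGeometry.HodgeTheory
open Literature.AlgebraicTopology.SingularHomology
open Literature.AlgebraicGeometry.Andre1996 (andre1996_cmAnchoredPencil
  andre1996_cmHodgeClasses_algebraicallyAnchoredPencils)
open Summit.Ventures.HSemireg (ObjClass LocalVariationalHodgeFor)
open Summit.HodgeConjecture.HodgeConjecture.Ring2.Hypotheses (AbelianSchemeVHC)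
open Summit.HodgeConjecture.HodgeConjecture.Ring2.Binders
open Summit.HodgeConjecture.HodgeConjecture.Ring2.ClassTargets

variable {𝒳 S : SchemeOver ℂ}

/-! ## §1 Tools: the padded total space is quasi-projective and the padded pencil has a section -/

/-- **`𝒳 × B` is quasi-projective over `ℂ` for `𝒳` quasi-projective and `B` projective**: with `j : 𝒳 ↪ P` an open
immersion into a projective `P`, `j ▷ B : 𝒳 × B ⟶ P × B` is an open immersion (base change,
`SectionFamily.isPullback_fst_whiskerRight`) into the projective `P × B` (Segre, `IsProjectiveOver.tensor`).
[cite: Hartshorne1977, II Ex. 4.9 and II §4 (p. 103)] -/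
theorem isQuasiProjectiveOver_tensor (h𝒳 : IsQuasiProjectiveOver 𝒳) {B : SchemeOver ℂ} (hB : IsProjectiveOver B) :
    IsQuasiProjectiveOver (𝒳 ⊗ B) := by
  obtain ⟨P, j, hP, hj⟩ := h𝒳
  refine ⟨P ⊗ B, j ▷ B, hP.tensor hB, ?_⟩
  haveI := hj
  have hsq : IsPullback (fst 𝒳 B).left (j ▷ B).left j.left (fst P B).left :=
    (SectionFamily.isPullback_fst_whiskerRight j B).map (Over.forget _)
  exact MorphismProperty.of_isPullback (P := @IsOpenImmersion) hsq hj

/-- **A section of `f` gives a section of the padded pencil `𝒳 × B ⟶ S`**: `(e, 0_B ∘ !)` with `0_B` the unit of the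
group scheme `B` (any `ℂ`-point of `B` would do). [cite: Hartshorne1977, II.3 (p. 89)] [cite: MumfordAV1970, §4 (definition)] -/
theorem exists_section_fst_comp (f : 𝒳 ⟶ S) (he : ∃ e : S ⟶ 𝒳, e ≫ f = 𝟙 S) (B : AbelianVariety ℂ) :
    ∃ e' : S ⟶ 𝒳 ⊗ B.X, e' ≫ (fst 𝒳 B.X ≫ f) = 𝟙 S := by
  obtain ⟨e, he⟩ := he
  exact ⟨lift e (toUnit S ≫ MonObj.one), by rw [← Category.assoc, lift_fst, he]⟩

/-! ## §2 One admissible datum at one fibre + the door ⟹ the algebraicity locus is uncountable (per pencil) -/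

/-- Functoriality bookkeeping (`(Iso.refl X).inv^* = id`). [folklore] -/
private theorem map_refl_inv'' (X : SchemeOver ℂ) (k : ℕ) (c : complexBetti X k) :
    complexBetti.map (Iso.refl X).inv k c = c := by
  rw [Iso.refl_inv, complexBetti.map_id]
  rfl

/-- **Door + ONE datum ⟹ the algebraicity locus of `W` is not countable** — the per-pencil content of the landed
`oneParameterAbelianSchemeVHCUncountable_of_lefAt` (p408365): on a smooth projective family `f : 𝒳 ⟶ S` of relative
dimension `n` over a smooth irreducible curve, an `𝒪`-admissible datum `(s₁, I ∋ p, κ, V, a ≠ 0, Z)` with `V_p = a·W + Z`,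
`κ_q = V_q|_{s₁}`, `V_q` fibrewise `(q,q)` and `Z` fibrewise algebraic, fed to the door `LocalVariationalHodgeFor 𝒪` at the
model `Iso.refl 𝒳_{s₁}`, makes `a·W| + Z|` — hence `W|` — algebraic on the path component of `s₁` in the door's open set,
which is uncountable (no affineness, section or abelian structure is used: those are binders of the CRUX, not of the argument).
[cite: BuchweitzFlenner2003, §5 Thm. 5.1 (argument shape)] [cite: VoisinHodgeI2002, §9.2.1 and Thm. 9.3]
[cite: SerreGAGA1956, §2 n°5 Prop. 2 and n°6] -/
theorem not_countable_algebraicityLocus_of_datum {𝒪 : ObjClass} (hT : LocalVariationalHodgeFor 𝒪) (f : 𝒳 ⟶ S)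
    {n : ℕ} (hf : IsSmoothProjectiveFamily f n) [IrreducibleSpace S.left] [AlgebraicGeometry.Smooth S.hom]
    (hdim : topologicalKrullDim S.left = 1) {p : ℕ} (W : complexBetti 𝒳 (2 * p))
    (hdatum : ∃ (s₁ : ComplexPoints S) (I : Finset ℕ) (κ : (q : ℕ) → complexBetti (fiberOver f s₁) (2 * q))
      (V : (q : ℕ) → complexBetti 𝒳 (2 * q)) (a : ℂ) (Z : complexBetti 𝒳 (2 * p)),
      p ∈ I ∧ 𝒪 n (fiberOver f s₁) I κ ∧ a ≠ 0 ∧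
      (∀ s : ComplexPoints S, complexBetti.map (fiberι f s) (2 * p) Z ∈ algebraicClasses (fiberOver f s) p) ∧
      V p = a • W + Z ∧
      (∀ q ∈ I, κ q = complexBetti.map (fiberι f s₁) (2 * q) (V q)) ∧
      (∀ q ∈ I, ∀ s : ComplexPoints S,
        IsOfHodgeType n (fiberOver f s) (2 * q) q q (complexBetti.map (fiberι f s) (2 * q) (V q)))) :
    ¬ {s : ComplexPoints S |
        complexBetti.map (fiberι f s) (2 * p) W ∈ algebraicClasses (fiberOver f s) p}.Countable := by
  haveI : LocallyOfFiniteType S.hom := inferInstance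
  haveI : LocallyPathConnectedSpace (ComplexPoints S) := locallyPathConnectedSpace_complexPoints_of_smooth S
  have hU : IsCohomologicallyLocallyTrivialOn f (Set.univ : Set (ComplexPoints S)) :=
    isCohomologicallyLocallyTrivialOn_univ_of_isSmoothProjectiveFamily_of_smooth f hf
  obtain ⟨s₁, I, κ, V, a, Z, hpI, hκ, ha, hZ, hVp, hκV, hVH⟩ := hdatum
  let s₁' : (Set.univ : Set (ComplexPoints S)) := ⟨s₁, Set.mem_univ s₁⟩
  have hHodge : ∀ q ∈ I, ∀ (t : (Set.univ : Set (ComplexPoints S))) (γ : Path.Homotopic.Quotient s₁' t),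
      IsOfHodgeType n (fiberOver f t.1) (2 * q) q q
        (transportFun f (2 * q) hU γ (complexBetti.map (Iso.refl (fiberOver f s₁)).inv (2 * q) (κ q))) := by
    intro q hq t γ
    rw [map_refl_inv'', hκV q hq, transportFun_map_fiberι f (2 * q) hU γ (V q)]
    exact hVH q hq t.1
  obtain ⟨W', hWo, hW'₁, hWU, hW'⟩ := hT f n hf ‹_› hU s₁' (fiberOver f s₁) (Iso.refl _) I κ hκ hHodge
  -- `W` is algebraic on the path component of `s₁` in `W'`
  have halg : ∀ t ∈ pathComponentIn W' s₁,
      complexBetti.map (fiberι f t) (2 * p) W ∈ algebraicClasses (fiberOver f t) p := by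
    intro t ht
    have hj : JoinedIn W' s₁ t := ht
    have hpm : ∀ u, hj.somePath u ∈ W' := hj.somePath_mem
    let γ : Path (⟨s₁, hW'₁⟩ : W') ⟨t, pathComponentIn_subset ht⟩ :=
      { toFun := fun u ↦ ⟨hj.somePath u, hpm u⟩
        continuous_toFun := hj.somePath.continuous.subtype_mk _
        source' := Subtype.ext hj.somePath.source
        target' := Subtype.ext hj.somePath.target }
    have hmem := hW' p hpI ⟨t, pathComponentIn_subset ht⟩ ⟦γ⟧
    have htr : transportFun f (2 * p) (hU.mono hWU hWo) ⟦γ⟧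
        (complexBetti.map (Iso.refl (fiberOver f s₁)).inv (2 * p) (κ p)) =
        a • complexBetti.map (fiberι f t) (2 * p) W + complexBetti.map (fiberι f t) (2 * p) Z := by
      rw [map_refl_inv'', hκV p hpI, transportFun_map_fiberι f (2 * p) (hU.mono hWU hWo) ⟦γ⟧ (V p), hVp,
        map_add, map_smul]
    change transportFun f (2 * p) (hU.mono hWU hWo) ⟦γ⟧
        (complexBetti.map (Iso.refl (fiberOver f s₁)).inv (2 * p) (κ p)) ∈ _ at hmem
    rw [htr] at hmem
    have hWt : complexBetti.map (fiberι f t) (2 * p) W =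
        a⁻¹ • ((a • complexBetti.map (fiberι f t) (2 * p) W + complexBetti.map (fiberι f t) (2 * p) Z) -
          complexBetti.map (fiberι f t) (2 * p) Z) := by
      rw [add_sub_cancel_right, smul_smul, inv_mul_cancel₀ ha, one_smul]
    rw [hWt]
    exact Submodule.smul_mem _ _ (Submodule.sub_mem _ hmem (hZ t))
  intro hc
  exact not_countable_of_isOpen_of_curve hdim (hWo.pathComponentIn s₁) ⟨s₁, mem_pathComponentIn_self hW'₁⟩
    (hc.mono fun t ht => halg t ht)

/-- **The graded crux at `(n, p)` + the door ⟹ the conclusion of node (U) at `(n, p)`** (per pencil): the datum of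
`AdmissibleRepresentativesLefAtDeg 𝒪 n p` on the given pencil, then §2. [cite: BuchweitzFlenner2003, §5 Thm. 5.1]
[cite: CharlesSchnell2014Notes, Prop. 11.3.11 (proof)] -/
theorem not_countable_algebraicityLocus_of_lefAtDeg {𝒪 : ObjClass} (hT : LocalVariationalHodgeFor 𝒪) {n p : ℕ}
    (hSR : AdmissibleRepresentativesLefAtDeg 𝒪 n p) (f : 𝒳 ⟶ S) (hf : IsSmoothProjectiveFamily f n)
    (h𝒳 : IsQuasiProjectiveOver 𝒳) [IrreducibleSpace S.left] [IsAffine S.left] [AlgebraicGeometry.Smooth S.hom]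
    (hdim : topologicalKrullDim S.left = 1)
    (habel : ∀ s : ComplexPoints S, ∃ A' : AbelianVariety ℂ, A'.dim = n ∧ Nonempty (A'.X ≅ fiberOver f s))
    (he : ∃ e : S ⟶ 𝒳, e ≫ f = 𝟙 S) (W : complexBetti 𝒳 (2 * p))
    (hW : ∀ s : ComplexPoints S, IsRationalClass (complexBetti.map (fiberι f s) (2 * p) W) ∧
      IsOfHodgeType n (fiberOver f s) (2 * p) p p (complexBetti.map (fiberι f s) (2 * p) W))
    {s₀ : ComplexPoints S} (hs₀ : complexBetti.map (fiberι f s₀) (2 * p) W ∈ algebraicClasses (fiberOver f s₀) p) :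
    ¬ {s : ComplexPoints S |
        complexBetti.map (fiberι f s) (2 * p) W ∈ algebraicClasses (fiberOver f s) p}.Countable := by
  obtain ⟨s₁, I, κ, V, a, Z, hpI, hκ, ha, hZ, hVp, hκV, hVH⟩ :=
    hSR f hf h𝒳 ‹_› ‹_› ‹_› hdim habel he W hW s₀ hs₀
  exact not_countable_algebraicityLocus_of_datum hT f hf hdim W
    ⟨s₁, I, κ, V, a, Z, hpI, hκ, ha, fun s => (hZ s).1, hVp, hκV, hVH⟩

/-! ## §3 The engine: lower shadow, then the middle lift of the padded pencil (the loci coincide as sets) -/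

/-- **The conclusion of node (U) at `(n, p)` from the DIAGONAL cells above `G`, per pencil** (`G < n`, `2p ≤ n`): pad the
pencil by an abelian variety `B` of dimension `n − 2p` (nothing to do if `2p = n`); the padded pencil `𝒳 × B ⟶ S` is a
one-parameter abelian scheme of relative dimension `2(n − p)` over the same curve, with a section and quasi-projective total
space (§1, `exists_middleLift`), the middle lift `W♯` of `W` is algebraic at `s₀`, and its algebraicity locus IS that of `W`;
the graded crux at the diagonal cell `(2(n − p), n − p)` — available since `2(n − p) > G` — and the door conclude (§2).
[cite: BrosnanFangNiePearlstein2009, §6 Lemma 48] [cite: Lieberman1968, main theorem] [cite: BuchweitzFlenner2003, §5 Thm. 5.1] -/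
theorem not_countable_algebraicityLocus_of_diagonal_of_lowerHalf {𝒪 : ObjClass} (hT : LocalVariationalHodgeFor 𝒪)
    {G : ℕ} (hSR : ∀ m : ℕ, G < 2 * m → AdmissibleRepresentativesLefAtDeg 𝒪 (2 * m) m)
    (f : 𝒳 ⟶ S) {n : ℕ} (hf : IsSmoothProjectiveFamily f n) (hGn : G < n) (h𝒳 : IsQuasiProjectiveOver 𝒳)
    [IrreducibleSpace S.left] [IsAffine S.left] [AlgebraicGeometry.Smooth S.hom] (hdim : topologicalKrullDim S.left = 1)
    (habel : ∀ s : ComplexPoints S, ∃ A' : AbelianVariety ℂ, A'.dim = n ∧ Nonempty (A'.X ≅ fiberOver f s))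
    (he : ∃ e : S ⟶ 𝒳, e ≫ f = 𝟙 S) {p : ℕ} (hpn : 2 * p ≤ n) (W : complexBetti 𝒳 (2 * p))
    (hW : ∀ s : ComplexPoints S, IsRationalClass (complexBetti.map (fiberι f s) (2 * p) W) ∧
      IsOfHodgeType n (fiberOver f s) (2 * p) p p (complexBetti.map (fiberι f s) (2 * p) W))
    {s₀ : ComplexPoints S} (hs₀ : complexBetti.map (fiberι f s₀) (2 * p) W ∈ algebraicClasses (fiberOver f s₀) p) :
    ¬ {s : ComplexPoints S |
        complexBetti.map (fiberι f s) (2 * p) W ∈ algebraicClasses (fiberOver f s) p}.Countable := by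
  haveI : LocallyOfFiniteType S.hom := inferInstance
  haveI : IsSeparated S.hom := (IsQuasiProjectiveOver.of_isAffine S).isSeparated
  rcases Nat.eq_or_lt_of_le hpn with hmid | hlt
  · -- already in the middle: the diagonal cell `(2p, p)` of the pencil itself
    subst hmid
    exact not_countable_algebraicityLocus_of_lefAtDeg hT (hSR p hGn) f hf h𝒳 hdim habel he W hW hs₀
  · -- pad by `B`, `dim B = n - 2p ≥ 1`, and lift `W` to the middle of `𝒳 × B ⟶ S`
    obtain ⟨B, hB⟩ := exists_abelianVariety_dim_eq_succ ℂ (n - 2 * p - 1)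
    have hpB : 2 * p + B.dim = n := by omega
    obtain ⟨hf', habel', W', hW', hiff⟩ := exists_middleLift f hf h𝒳 habel B hpB W hW
    have hmid : n + B.dim = 2 * (p + B.dim) := by omega
    rw [hmid] at hf' habel' hW'
    have h := not_countable_algebraicityLocus_of_lefAtDeg hT (hSR (p + B.dim) (by omega)) (fst 𝒳 B.X ≫ f) hf'
      (isQuasiProjectiveOver_tensor h𝒳 (AbelianVariety.isSmoothProjective_holds (A := B)).isProjectiveOver) hdim habel'
      (exists_section_fst_comp f he B) W' hW' ((hiff s₀).2 hs₀)
    have hset : {s : ComplexPoints S | complexBetti.map (fiberι (fst 𝒳 B.X ≫ f) s) (2 * (p + B.dim)) W' ∈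
          algebraicClasses (fiberOver (fst 𝒳 B.X ≫ f) s) (p + B.dim)} =
        {s : ComplexPoints S | complexBetti.map (fiberι f s) (2 * p) W ∈ algebraicClasses (fiberOver f s) p} :=
      Set.ext fun s => hiff s
    rwa [hset] at h

/-- **The conclusion of node (U) at `(n, p)` from the DIAGONAL cells above `G`, per pencil, EVERY `p`** (`G < n`): beyond
`p > n` there are no non-zero `(p,p)`-classes (every fibre is algebraic and `S(ℂ)` is uncountable); above the middle pass to
ring2-b02's LOWER SHADOW `W♭` of codimension `n − p` (same algebraicity locus, Lieberman's `B(A)` on the fibres); then §3's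
padding. [cite: KerrPearlstein2011, §3.1] [cite: Lieberman1968, main theorem] [cite: BrosnanFangNiePearlstein2009, §6 Lemma 48] -/
theorem not_countable_algebraicityLocus_of_diagonal {𝒪 : ObjClass} (hT : LocalVariationalHodgeFor 𝒪)
    {G : ℕ} (hSR : ∀ m : ℕ, G < 2 * m → AdmissibleRepresentativesLefAtDeg 𝒪 (2 * m) m)
    (f : 𝒳 ⟶ S) {n : ℕ} (hf : IsSmoothProjectiveFamily f n) (hGn : G < n) (h𝒳 : IsQuasiProjectiveOver 𝒳)
    [IrreducibleSpace S.left] [IsAffine S.left] [AlgebraicGeometry.Smooth S.hom] (hdim : topologicalKrullDim S.left = 1)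
    (habel : ∀ s : ComplexPoints S, ∃ A' : AbelianVariety ℂ, A'.dim = n ∧ Nonempty (A'.X ≅ fiberOver f s))
    (he : ∃ e : S ⟶ 𝒳, e ≫ f = 𝟙 S) (p : ℕ) (W : complexBetti 𝒳 (2 * p))
    (hW : ∀ s : ComplexPoints S, IsRationalClass (complexBetti.map (fiberι f s) (2 * p) W) ∧
      IsOfHodgeType n (fiberOver f s) (2 * p) p p (complexBetti.map (fiberι f s) (2 * p) W))
    {s₀ : ComplexPoints S} (hs₀ : complexBetti.map (fiberι f s₀) (2 * p) W ∈ algebraicClasses (fiberOver f s₀) p) :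
    ¬ {s : ComplexPoints S |
        complexBetti.map (fiberι f s) (2 * p) W ∈ algebraicClasses (fiberOver f s) p}.Countable := by
  haveI : LocallyOfFiniteType S.hom := inferInstance
  by_cases hpn : 2 * p ≤ n
  · exact not_countable_algebraicityLocus_of_diagonal_of_lowerHalf hT hSR f hf hGn h𝒳 hdim habel he hpn W hW hs₀
  by_cases hnp : n < p
  · -- no non-zero `(p,p)`-classes: every fibre is algebraic
    have huniv : {s : ComplexPoints S |
        complexBetti.map (fiberι f s) (2 * p) W ∈ algebraicClasses (fiberOver f s) p} = Set.univ :=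
      Set.eq_univ_of_forall fun s => by
        rw [Set.mem_setOf_eq, (hW s).2.eq_zero_pp_of_lt hnp]
        exact Submodule.zero_mem _
    rw [huniv]
    exact not_countable_of_isOpen_of_curve hdim isOpen_univ ⟨s₀, Set.mem_univ _⟩
  · -- above the middle: the lower shadow of codimension `n - p`
    obtain ⟨q, j, hqj, hp⟩ : ∃ q j : ℕ, 2 * q + j = n ∧ q + j = p := ⟨n - p, 2 * p - n, by omega, by omega⟩
    subst hp
    obtain ⟨W', hW', hiff⟩ := exists_lowerShadow f hf h𝒳 (IsQuasiProjectiveOver.of_isAffine S) ‹_› habel hqj W hW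
    have h := not_countable_algebraicityLocus_of_diagonal_of_lowerHalf hT hSR f hf hGn h𝒳 hdim habel he (by omega) W'
      hW' ((hiff s₀).2 hs₀)
    have hset : {s : ComplexPoints S | complexBetti.map (fiberι f s) (2 * q) W' ∈ algebraicClasses (fiberOver f s) q} =
        {s : ComplexPoints S | complexBetti.map (fiberι f s) (2 * (q + j)) W ∈
          algebraicClasses (fiberOver f s) (q + j)} :=
      Set.ext fun s => hiff s
    rwa [hset] at h

/-- **The slices of relative dimension `≤ G` from the class target `HCUpToDim G`, per pencil**: every fibre is algebraic
(`Ring2.Binders.abelianSchemeVHC_conclusion_of_hcAtDim`), so the locus is all of the uncountable `S(ℂ)`.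
[cite: CharlesSchnell2014Notes, Cor. 11.3.6] [cite: SerreGAGA1956, §2 n°5 Prop. 2 and n°6] -/
theorem not_countable_algebraicityLocus_of_hcUpToDim {G : ℕ} (hG : HCUpToDim G) (f : 𝒳 ⟶ S) {n : ℕ} (hn : n ≤ G)
    [IrreducibleSpace S.left] [AlgebraicGeometry.Smooth S.hom] (hdim : topologicalKrullDim S.left = 1)
    (habel : ∀ s : ComplexPoints S, ∃ A' : AbelianVariety ℂ, A'.dim = n ∧ Nonempty (A'.X ≅ fiberOver f s))
    (p : ℕ) (W : complexBetti 𝒳 (2 * p))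
    (hW : ∀ s : ComplexPoints S, IsRationalClass (complexBetti.map (fiberι f s) (2 * p) W) ∧
      IsOfHodgeType n (fiberOver f s) (2 * p) p p (complexBetti.map (fiberι f s) (2 * p) W))
    (s₀ : ComplexPoints S) :
    ¬ {s : ComplexPoints S |
        complexBetti.map (fiberι f s) (2 * p) W ∈ algebraicClasses (fiberOver f s) p}.Countable := by
  have huniv : {s : ComplexPoints S |
      complexBetti.map (fiberι f s) (2 * p) W ∈ algebraicClasses (fiberOver f s) p} = Set.univ :=
    Set.eq_univ_of_forall fun s =>
      abelianSchemeVHC_conclusion_of_hcAtDim f W s (hcAtDim_of_hcUpToDim (hcUpToDim_mono hn hG)) (habel s) (hW s)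
  rw [huniv]
  exact not_countable_of_isOpen_of_curve hdim isOpen_univ ⟨s₀, Set.mem_univ _⟩

/-! ## §4 The nodes: (U), row b02 and `HC_AV` from the door and the DIAGONAL of the crux -/

/-- **Node (U) from the door, the class target `HCUpToDim G` and the diagonal cells `(2m, m)` with `2m > G` of the
graded crux.** [cite: CharlesSchnell2014Notes, Conj. 11.3.1 and Prop. 11.3.11 (proof)] [cite: BrosnanFangNiePearlstein2009, §6 Lemma 48]
[cite: Lieberman1968, main theorem] [cite: BuchweitzFlenner2003, §5 Thm. 5.1] -/
theorem oneParameterAbelianSchemeVHCUncountable_of_hcUpToDim_of_lefAtDeg_diagonal {𝒪 : ObjClass}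
    (hT : LocalVariationalHodgeFor 𝒪) {G : ℕ} (hG : HCUpToDim G)
    (hSR : ∀ m : ℕ, G < 2 * m → AdmissibleRepresentativesLefAtDeg 𝒪 (2 * m) m) : OneParameterAbelianSchemeVHCUncountable := by
  intro n 𝒳 S f hf h𝒳 hirr haff hsm hdim habel he p W hW s₀ hs₀
  haveI := hirr
  haveI := haff
  haveI := hsm
  rcases Nat.lt_or_ge G n with hGn | hnG
  · exact not_countable_algebraicityLocus_of_diagonal hT hSR f hf hGn h𝒳 hdim habel he p W hW hs₀
  · exact not_countable_algebraicityLocus_of_hcUpToDim hG f hnG hdim habel p W hW s₀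

/-- **Node (U) from the door and the diagonal cells `(2m, m)`, `m ≥ 2`, of the graded crux — FACT-FREE** (relative
dimension `≤ 3` is unconditional: `Ring2.ClassTargets.hcUpToDim_three`, Lefschetz `(1,1)` and hard Lefschetz on threefolds).
First cell used: `(4, 2)`. [cite: VoisinHodgeII2003, §10.2.3 proof of Prop. 10.26] [cite: BrosnanFangNiePearlstein2009, §6 Lemma 48] -/
theorem oneParameterAbelianSchemeVHCUncountable_of_lefAtDeg_diagonal_two {𝒪 : ObjClass} (hT : LocalVariationalHodgeFor 𝒪)
    (hSR : ∀ m : ℕ, 2 ≤ m → AdmissibleRepresentativesLefAtDeg 𝒪 (2 * m) m) : OneParameterAbelianSchemeVHCUncountable :=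
  oneParameterAbelianSchemeVHCUncountable_of_hcUpToDim_of_lefAtDeg_diagonal hT hcUpToDim_three
    fun m hm => hSR m (by omega)

/-- **Node (U) from the door, `HCUpToDim 5` (Markman 2025 Cor. 1.3, UNREFEREED — the support item `HodgeAbelianDimLeFive`
by `Ring2.ClassTargets.hcUpToDim_five_iff_hodgeAbelianDimLeFive`) and the diagonal cells `(2m, m)`, `m ≥ 3`.** First cell
used: `(6, 3)` — the BC5 rung. [cite: Markman2025SurveySecant, Cor. 1.3] [cite: BrosnanFangNiePearlstein2009, §6 Lemma 48] -/
theorem oneParameterAbelianSchemeVHCUncountable_of_hcUpToDim_five_of_lefAtDeg_diagonal_three {𝒪 : ObjClass}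
    (hT : LocalVariationalHodgeFor 𝒪) (h₅ : HCUpToDim 5)
    (hSR : ∀ m : ℕ, 3 ≤ m → AdmissibleRepresentativesLefAtDeg 𝒪 (2 * m) m) : OneParameterAbelianSchemeVHCUncountable :=
  oneParameterAbelianSchemeVHCUncountable_of_hcUpToDim_of_lefAtDeg_diagonal hT h₅ fun m hm => hSR m (by omega)

/-- **Row b02 from the door, the diagonal `m ≥ 2` and the curve residual — no class target.**
[cite: CharlesSchnell2014Notes, Prop. 11.3.11 (proof)] [cite: GortzWedhorn2023, Thm. 27.291] -/
theorem abelianSchemeVHC_of_lefAtDeg_diagonal_two {𝒪 : ObjClass} (hT : LocalVariationalHodgeFor 𝒪)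
    (hSR : ∀ m : ℕ, 2 ≤ m → AdmissibleRepresentativesLefAtDeg 𝒪 (2 * m) m)
    (hqp : OneParameterAbelianSchemeQuasiProjective) : AbelianSchemeVHC :=
  abelianSchemeVHC_of_uncountable_of_oneParameterAbelianSchemeQuasiProjective hqp
    (oneParameterAbelianSchemeVHCUncountable_of_lefAtDeg_diagonal_two hT hSR)

/-- **Row b02 from the door, `HCUpToDim 5`, the diagonal `m ≥ 3` and the curve residual.**
[cite: CharlesSchnell2014Notes, Prop. 11.3.11 (proof)] [cite: Markman2025SurveySecant, Cor. 1.3] [cite: GortzWedhorn2023, Thm. 27.291] -/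
theorem abelianSchemeVHC_of_hcUpToDim_five_of_lefAtDeg_diagonal_three {𝒪 : ObjClass} (hT : LocalVariationalHodgeFor 𝒪)
    (h₅ : HCUpToDim 5) (hSR : ∀ m : ℕ, 3 ≤ m → AdmissibleRepresentativesLefAtDeg 𝒪 (2 * m) m)
    (hqp : OneParameterAbelianSchemeQuasiProjective) : AbelianSchemeVHC :=
  abelianSchemeVHC_of_uncountable_of_oneParameterAbelianSchemeQuasiProjective hqp
    (oneParameterAbelianSchemeVHCUncountable_of_hcUpToDim_five_of_lefAtDeg_diagonal_three hT h₅ hSR)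

/-- **`HC_AV` from the door, the DIAGONAL `(2m, m)`, `m ≥ 2`, of the crux, the curve residual and André 1996 #21/#22 — no
class target, no `HC_CM`.** The `hc_av_of_lefAt` of p408365 with the crux replaced by its diagonal slice.
[cite: Andre1996Motifs, §6.3 Lemmes 6.3.1–6.3.3 and Remarque 2 (p. 33)] [cite: BrosnanFangNiePearlstein2009, §6 Lemma 48] -/
theorem hc_av_of_lefAtDeg_diagonal_two {𝒪 : ObjClass} (hT : LocalVariationalHodgeFor 𝒪)
    (hSR : ∀ m : ℕ, 2 ≤ m → AdmissibleRepresentativesLefAtDeg 𝒪 (2 * m) m)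
    (hqp : OneParameterAbelianSchemeQuasiProjective) (h₂₁ : andre1996_cmAnchoredPencil)
    (h₂₂ : andre1996_cmHodgeClasses_algebraicallyAnchoredPencils) :
    Theses.PadicSemiregularLift.HodgeAbelianVarieties :=
  (Ring2.Deform.HC_AV_iff_abelianSchemeVHC_of_andre1996 h₂₁ h₂₂).mpr (abelianSchemeVHC_of_lefAtDeg_diagonal_two hT hSR hqp)

/-- **`HC_AV` from the door, `HCUpToDim 5`, the DIAGONAL `(2m, m)`, `m ≥ 3`, of the crux, the curve residual and André
1996 #21/#22 — no `HC_CM`.** [cite: Andre1996Motifs, §6.3 Lemmes 6.3.1–6.3.3 and Remarque 2 (p. 33)]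
[cite: Markman2025SurveySecant, Cor. 1.3] [cite: BrosnanFangNiePearlstein2009, §6 Lemma 48] -/
theorem hc_av_of_hcUpToDim_five_of_lefAtDeg_diagonal_three {𝒪 : ObjClass} (hT : LocalVariationalHodgeFor 𝒪)
    (h₅ : HCUpToDim 5) (hSR : ∀ m : ℕ, 3 ≤ m → AdmissibleRepresentativesLefAtDeg 𝒪 (2 * m) m)
    (hqp : OneParameterAbelianSchemeQuasiProjective) (h₂₁ : andre1996_cmAnchoredPencil)
    (h₂₂ : andre1996_cmHodgeClasses_algebraicallyAnchoredPencils) :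
    Theses.PadicSemiregularLift.HodgeAbelianVarieties :=
  (Ring2.Deform.HC_AV_iff_abelianSchemeVHC_of_andre1996 h₂₁ h₂₂).mpr
    (abelianSchemeVHC_of_hcUpToDim_five_of_lefAtDeg_diagonal_three hT h₅ hSR hqp)

/-! ## §5 Over the road's TWISTED door: regime 2 on the diagonal suffices (the `closes`-shape with the crux sliced) -/

/-- **The graded crux over the twisted door from its regime 2 at `(n, p)`** (regime 1 holds by the null datum,
`lefAtLefschetzRegime_twistedReflexiveClass`), for every admissibility notion containing Buchweitz–Flenner's.
[cite: vanGeemen1994HodgeAV, §2.4] [cite: BuchweitzFlenner2003, §5 Thm. 5.1] -/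
theorem admissibleRepresentativesLefAtDeg_twisted_of_exceptionalRegimeAt (C : ChernCharacterBetti)
    {Adm : PerfectAdmissibility} (hAdm : ∀ n X₀ I E, bfSingleAdmissible n X₀ I E → Adm n X₀ I E) {n p : ℕ}
    (h : LefAtExceptionalRegimeAt (twistedReflexiveClass C Adm) n p) :
    AdmissibleRepresentativesLefAtDeg (twistedReflexiveClass C Adm) n p :=
  admissibleRepresentativesLefAtDeg_of_regimes (lefAtLefschetzRegime_twistedReflexiveClass C Adm hAdm) h

/-- **`HC_AV` in the `closes`-shape of road b02 with the crux `SemiregularSheafRepresentativesTwAt` REPLACED by its diagonal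
slice `∀ C m, 2 ≤ m → LefAtExceptionalRegimeAt (twisted door) (2m) m`** — K-C, the twisted door, Raynaud, André #21/#22 as
in `Theses.VHCAbelianSchemesRoad.closes`; no class target, no `HC_CM`. First cell consumed: `(4, 2)`.
[cite: Andre1996Motifs, §6.3 Lemmes 6.3.1–6.3.3] [cite: BrosnanFangNiePearlstein2009, §6 Lemma 48]
[cite: Pridham2024Semiregularity, Cor. 2.25 and Rem. 2.27] [cite: GortzWedhorn2023, Thm. 27.291] -/
theorem hc_av_of_exceptionalRegimeAt_twisted_diagonal_two (hC : ChernCharacterOnBetti)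
    {Adm : PerfectAdmissibility} (hAdm : ∀ n X₀ I E, bfSingleAdmissible n X₀ I E → Adm n X₀ I E)
    (hDiag : ∀ (C : ChernCharacterBetti) (m : ℕ), 2 ≤ m → LefAtExceptionalRegimeAt (twistedReflexiveClass C Adm) (2 * m) m)
    (hDoor : ∀ C : ChernCharacterBetti, TwistedPerfectDoorVHC C Adm)
    (hR : raynaud1970_abelianScheme_section_projective) (h₂₁ : andre1996_cmAnchoredPencil)
    (h₂₂ : andre1996_cmHodgeClasses_algebraicallyAnchoredPencils) :
    Theses.PadicSemiregularLift.HodgeAbelianVarieties := by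
  obtain ⟨C⟩ := hC
  exact hc_av_of_lefAtDeg_diagonal_two (𝒪 := twistedReflexiveClass C Adm) (hDoor C)
    (fun m hm => admissibleRepresentativesLefAtDeg_twisted_of_exceptionalRegimeAt C hAdm (hDiag C m hm))
    (oneParameterAbelianSchemeQuasiProjective_of_raynaud1970 hR) h₂₁ h₂₂

/-- **`HC_AV` in the `closes`-shape of road b02 with the crux REPLACED by its diagonal slice from `(6, 3)` on,
`∀ C m, 3 ≤ m → LefAtExceptionalRegimeAt (twisted door) (2m) m`, granted `HCUpToDim 5`** (Markman 2025 Cor. 1.3, UNREFEREED).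
Of the `(n, p)`-table of regime 2 only the diagonal `(6,3), (8,4), (10,5), …` is consumed; the cells `(4,2)`, `(5,2)`, `(6,2)`,
`(6,4)`, … are bypassed (their carrier statements stay open and unused). [cite: Andre1996Motifs, §6.3 Lemmes 6.3.1–6.3.3]
[cite: Markman2025SurveySecant, Cor. 1.3] [cite: BrosnanFangNiePearlstein2009, §6 Lemma 48]
[cite: Pridham2024Semiregularity, Cor. 2.25 and Rem. 2.27] [cite: GortzWedhorn2023, Thm. 27.291] -/
theorem hc_av_of_hcUpToDim_five_of_exceptionalRegimeAt_twisted_diagonal_three (hC : ChernCharacterOnBetti)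
    {Adm : PerfectAdmissibility} (hAdm : ∀ n X₀ I E, bfSingleAdmissible n X₀ I E → Adm n X₀ I E) (h₅ : HCUpToDim 5)
    (hDiag : ∀ (C : ChernCharacterBetti) (m : ℕ), 3 ≤ m → LefAtExceptionalRegimeAt (twistedReflexiveClass C Adm) (2 * m) m)
    (hDoor : ∀ C : ChernCharacterBetti, TwistedPerfectDoorVHC C Adm)
    (hR : raynaud1970_abelianScheme_section_projective) (h₂₁ : andre1996_cmAnchoredPencil)
    (h₂₂ : andre1996_cmHodgeClasses_algebraicallyAnchoredPencils) :
    Theses.PadicSemiregularLift.HodgeAbelianVarieties := by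
  obtain ⟨C⟩ := hC
  exact hc_av_of_hcUpToDim_five_of_lefAtDeg_diagonal_three (𝒪 := twistedReflexiveClass C Adm) (hDoor C) h₅
    (fun m hm => admissibleRepresentativesLefAtDeg_twisted_of_exceptionalRegimeAt C hAdm (hDiag C m hm))
    (oneParameterAbelianSchemeQuasiProjective_of_raynaud1970 hR) h₂₁ h₂₂

end Summit.HodgeConjecture.HodgeConjecture.Ring2.SemiregularRepresentatives

end
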